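import Summits.CriticalPhenomena.PercolationContinuityZ3.Theorems.PercNonProliferationSubpolynomialBlockingSubsurface
import Literature.Probability.Percolation.SharpnessDCTProofs
import Literature.NumberTheory.LFunctions.NicolasOmega
import HarnessLib

/-!
# `SubpolynomialBlocking`, line `SketchIdeator5` (two-sided charging floor) — stub `stub_floorOfArmRates`

Support file for crux item stmt-CriticalPhenomena-4446 (`PercNonProliferation.SubpolynomialBlocking`,
`u_n = P_{p_c(ℤ³)}(Λ_n ↮ ∂ⁱⁿΛ_{2n} inside Λ_{2n})`). This is the TYPED CEILING of the two-sided charging line: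
pure real analysis over the three floor stubs of the line, which enter as HYPOTHESES.

With `m = n + ⌊n/2⌋`, `h_v = P(inArm v n)`, `g_v = P(outArm v n)` for `v ∈ ∂ⁱⁿΛ_m`:
* hypothesis 1 (`stub_productFloor`): `∏_{v ∈ ∂ⁱⁿΛ_m} (1 - h_v g_v) ≤ u_n(p)`;
* hypothesis 2 (`stub_inArm_le_halfSpaceReach`): `h_v ≤ H_n := P_p(halfSpaceReach 3 ⌊n/2⌋)`;
* hypothesis 3 (`stub_outArm_le_siteToBoundary`): `g_v ≤ G_n := P_p(siteToBoundary 3 (n - ⌊n/2⌋))`.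

CLAIM: a half-space reach rate `P_{p_c}(halfSpaceReach 3 n) ≤ C₁ n^{-a}` and a one-arm rate
`P_{p_c}(siteToBoundary 3 n) ≤ C₂ n^{-b}` give `exp(-C n^{2-a-b}) ≤ u_n` eventually, for some `C > 0`.

PROOF: (i) `H_n → 0` unconditionally (Barsky–Grimmett–Newman, the tree's `BarskyGrimmettNewman1991_Z3_holds`
through `CerfDembinVanishing.tendsto_measure_halfSpaceReach`), so eventually every `x_v := h_v g_v ∈ [0, 1/2]`;
(ii) `1 - x ≥ exp(-2x)` on `[0, 1/2]` (tree's `Nicolas.exp_neg_two_mul_le`), so `u_n ≥ exp(-2 Σ_v x_v)`,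
and `Σ_v x_v ≤ |∂ⁱⁿΛ_m| · H_n · G_n`;
(iii) `|∂ⁱⁿΛ_m| ≤ 6 (2m+1)² ≤ 96 n²` (`card_innerBoundary_box_le`), `H_n ≤ |C₁| max(4^a,1) n^{-a}`
(`n/4 ≤ ⌊n/2⌋ ≤ n`), `G_n ≤ |C₂| max(2^b,1) n^{-b}` (`n/2 ≤ n - ⌊n/2⌋ ≤ n`), and
`n² · n^{-a} · n^{-b} = n^{2-a-b}`.
-/

noncomputable section

namespace Summit.CriticalPhenomena.PercolationContinuityZ3.Theorems.SubpolynomialBlocking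

open MeasureTheory Filter Topology
open Literature.Probability.Percolation Literature.Probability.LatticeModels
open Literature.Probability.Percolation.DCT16
open Literature.Probability.Percolation.CerfDembinVanishing
open Literature.Barriers.CriticalPhenomena

namespace FloorOfArmRates

/-! ## Real-analysis glue -/

/-- Comparable bases, either sign of the exponent: for `0 < x ≤ y ≤ c x` with `1 ≤ c`,
`x^{-a} ≤ max (c^a) 1 · y^{-a}`. -/
theorem rpow_neg_le_max_mul {c x y : ℝ} (hc : 1 ≤ c) (hx : 0 < x) (hxy : x ≤ y) (hyx : y ≤ c * x)
    (a : ℝ) : x ^ (-a) ≤ max (c ^ a) 1 * y ^ (-a) := by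
  have hy : 0 < y := hx.trans_le hxy
  have hc0 : 0 < c := one_pos.trans_le hc
  have hya : 0 ≤ y ^ (-a) := Real.rpow_nonneg hy.le _
  rcases le_or_gt 0 a with ha | ha
  · have hdiv : y / c ≤ x := by
      rw [div_le_iff₀ hc0]
      linarith [mul_comm c x]
    have h1 : x ^ (-a) ≤ (y / c) ^ (-a) :=
      Real.rpow_le_rpow_of_nonpos (div_pos hy hc0) hdiv (neg_nonpos.2 ha)
    have h2 : (y / c) ^ (-a) = c ^ a * y ^ (-a) := by
      rw [Real.div_rpow hy.le hc0.le, Real.rpow_neg hc0.le, div_inv_eq_mul, mul_comm]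
    calc x ^ (-a) ≤ c ^ a * y ^ (-a) := h1.trans_eq h2
      _ ≤ max (c ^ a) 1 * y ^ (-a) := mul_le_mul_of_nonneg_right (le_max_left _ _) hya
  · calc x ^ (-a) ≤ y ^ (-a) := Real.rpow_le_rpow hx.le hxy (by linarith)
      _ = 1 * y ^ (-a) := (one_mul _).symm
      _ ≤ max (c ^ a) 1 * y ^ (-a) := mul_le_mul_of_nonneg_right (le_max_right _ _) hya

/-- `n² · n^{-a} · n^{-b} = n^{2-a-b}` for `0 < n`. -/
theorem rpow_two_sub_sub {x : ℝ} (hx : 0 < x) (a b : ℝ) :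
    x ^ (2 - a - b) = x ^ (2 : ℕ) * (x ^ (-a) * x ^ (-b)) := by
  rw [show (2 - a - b : ℝ) = ((2 : ℕ) : ℝ) + ((-a) + (-b)) by push_cast; ring, Real.rpow_add hx,
    Real.rpow_add hx, Real.rpow_natCast]

/-! ## The mid-sphere has at most `96 n²` sites -/

/-- `|∂ⁱⁿΛ_m| ≤ 96 n²` for `m = n + ⌊n/2⌋`, `n ≥ 1` (from `|∂ⁱⁿΛ_m| ≤ 2·3·(2m+1)²` and `2m + 1 ≤ 4n`). -/
theorem card_midSphere_le {n : ℕ} (hn : 1 ≤ n) :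
    (innerBoundary (zdGraph 3) (box 3 (n + n / 2))).card ≤ 96 * n ^ 2 := by
  have h1 := Literature.Probability.Percolation.card_innerBoundary_box_le (d := 3) (n + n / 2)
  have h2 : 2 * (n + n / 2) + 1 ≤ 4 * n := by omega
  have h3 : (2 * (n + n / 2) + 1) ^ (3 - 1) ≤ (4 * n) ^ (3 - 1) := Nat.pow_le_pow_left h2 _
  calc (innerBoundary (zdGraph 3) (box 3 (n + n / 2))).card ≤ 2 * 3 * (2 * (n + n / 2) + 1) ^ (3 - 1) := h1
    _ ≤ 2 * 3 * (4 * n) ^ (3 - 1) := Nat.mul_le_mul_left _ h3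
    _ = 96 * n ^ 2 := by norm_num; ring

/-- Real-cast form: `(|∂ⁱⁿΛ_m| : ℝ) ≤ 96 n²`. -/
theorem card_midSphere_le_real {n : ℕ} (hn : 1 ≤ n) :
    ((innerBoundary (zdGraph 3) (box 3 (n + n / 2))).card : ℝ) ≤ 96 * (n : ℝ) ^ (2 : ℕ) := by
  exact_mod_cast card_midSphere_le hn

/-! ## BGN smallness of the inward arm bound -/

/-- BGN: the half-space reach probability at depth `⌊n/2⌋` tends to `0` at `p_c(ℤ³)` (tree's proved
`BarskyGrimmettNewman1991_Z3_holds` through `CerfDembinVanishing.tendsto_measure_halfSpaceReach`). -/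
theorem tendsto_halfSpaceReach_half :
    Tendsto (fun n : ℕ => (bondPercolation (zdGraph 3) (criticalProbI 3)).real (halfSpaceReach 3 (n / 2)))
      atTop (𝓝 0) := by
  have h' : Tendsto (fun t => ((bondPercolation (zdGraph 3) (criticalProbI 3)) (halfSpaceReach 3 t)).toReal) atTop
      (𝓝 (0 : ENNReal).toReal) :=
    (ENNReal.tendsto_toReal ENNReal.zero_ne_top).comp
      (tendsto_measure_halfSpaceReach (criticalProbI 3) BarskyGrimmettNewman1991_Z3_holds)
  rw [ENNReal.toReal_zero] at h'
  have h'' : Tendsto (fun t : ℕ => (bondPercolation (zdGraph 3) (criticalProbI 3)).real (halfSpaceReach 3 t))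
      atTop (𝓝 0) := by
    simpa only [measureReal_def] using h'
  exact h''.comp (tendsto_atTop_atTop.2 fun b => ⟨2 * b, fun a ha => by omega⟩)

/-! ## The abstract floor -/

/-- **Abstract form of the typed ceiling.** Index sets `S n` of size `≤ 96 n²`, weights `h n v, g n v ∈ [0, 1]`
with `∏_{v ∈ S n} (1 - h g) ≤ u n`, `h n v ≤ Hs ⌊n/2⌋`, `g n v ≤ Gs (n - ⌊n/2⌋)`, `Hs ⌊n/2⌋ → 0`, and rates
`Hs n ≤ C₁ n^{-a}`, `Gs n ≤ C₂ n^{-b}` (`n ≥ 1`) give `exp(-C n^{2-a-b}) ≤ u n` eventually, for some `C > 0`. -/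
theorem floor_abstract {ι : Type*} (S : ℕ → Finset ι) (Hs Gs : ℕ → ℝ) {u : ℕ → ℝ} {h g : ℕ → ι → ℝ}
    {a b C₁ C₂ : ℝ}
    (hpf : ∀ n, 1 ≤ n → ∏ v ∈ S n, (1 - h n v * g n v) ≤ u n)
    (hin : ∀ n v, v ∈ S n → h n v ≤ Hs (n / 2))
    (hout : ∀ n v, 1 ≤ n → v ∈ S n → g n v ≤ Gs (n - n / 2))
    (h0 : ∀ n v, 0 ≤ h n v) (g0 : ∀ n v, 0 ≤ g n v) (g1 : ∀ n v, g n v ≤ 1)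
    (Hs0 : ∀ n, 0 ≤ Hs n) (Gs0 : ∀ n, 0 ≤ Gs n)
    (hS : ∀ n, 1 ≤ n → ((S n).card : ℝ) ≤ 96 * (n : ℝ) ^ (2 : ℕ))
    (hlim : Tendsto (fun n : ℕ => Hs (n / 2)) atTop (𝓝 0))
    (hA : ∀ n : ℕ, 1 ≤ n → Hs n ≤ C₁ * (n : ℝ) ^ (-a))
    (hB : ∀ n : ℕ, 1 ≤ n → Gs n ≤ C₂ * (n : ℝ) ^ (-b)) :
    ∃ C : ℝ, 0 < C ∧ ∀ᶠ n : ℕ in atTop, Real.exp (-(C * (n : ℝ) ^ (2 - a - b))) ≤ u n := by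
  refine ⟨2 * 96 * (|C₁| + 1) * (|C₂| + 1) * max (4 ^ a) 1 * max (2 ^ b) 1, by positivity, ?_⟩
  have hev : ∀ᶠ n : ℕ in atTop, Hs (n / 2) < 1 / 2 := hlim.eventually (gt_mem_nhds (by norm_num))
  filter_upwards [hev, eventually_ge_atTop 2] with n hn hn2
  have hn1 : 1 ≤ n := by omega
  have hnpos : (0 : ℝ) < n := by exact_mod_cast (show 0 < n by omega)
  -- (i)-(ii): the product floor in exponential form
  have hx_half : ∀ v ∈ S n, h n v * g n v ≤ 1 / 2 := fun v hv =>
    calc h n v * g n v ≤ 1 / 2 * 1 := mul_le_mul ((hin n v hv).trans hn.le) (g1 n v) (g0 n v) (by norm_num)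
      _ = 1 / 2 := by norm_num
  have hfloor : Real.exp (-(2 * ∑ v ∈ S n, h n v * g n v)) ≤ u n := by
    refine le_trans ?_ (hpf n hn1)
    rw [show -(2 * ∑ v ∈ S n, h n v * g n v) = ∑ v ∈ S n, -(2 * (h n v * g n v)) by
      rw [Finset.sum_neg_distrib, Finset.mul_sum], Real.exp_sum]
    exact Finset.prod_le_prod (fun v _ => (Real.exp_pos _).le) fun v hv =>
      Literature.NumberTheory.LFunctions.Nicolas.exp_neg_two_mul_le (mul_nonneg (h0 n v) (g0 n v)) (hx_half v hv)
  refine le_trans ?_ hfloor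
  rw [Real.exp_le_exp, neg_le_neg_iff]
  -- `Σ_v h g ≤ |S n| · Hs · Gs`
  have hsum : ∑ v ∈ S n, h n v * g n v ≤ ((S n).card : ℝ) * (Hs (n / 2) * Gs (n - n / 2)) := by
    have := Finset.sum_le_sum fun v hv =>
      (mul_le_mul (hin n v hv) (hout n v hn1 hv) (g0 n v) (Hs0 _) : h n v * g n v ≤ Hs (n / 2) * Gs (n - n / 2))
    rwa [Finset.sum_const, nsmul_eq_mul] at this
  -- (iii): the rates at `⌊n/2⌋` and `n - ⌊n/2⌋`, moved to base `n`
  have hk1 : 1 ≤ n / 2 := by omega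
  have hkx : (0 : ℝ) < ((n / 2 : ℕ) : ℝ) := Nat.cast_pos.2 (by omega)
  have hk_le : ((n / 2 : ℕ) : ℝ) ≤ (n : ℝ) := Nat.cast_le.2 (Nat.div_le_self n 2)
  have hk_ge : (n : ℝ) ≤ 4 * ((n / 2 : ℕ) : ℝ) := by
    have : n ≤ 4 * (n / 2) := by omega
    exact_mod_cast this
  have hHr : Hs (n / 2) ≤ |C₁| * (max (4 ^ a) 1 * (n : ℝ) ^ (-a)) :=
    calc Hs (n / 2) ≤ C₁ * ((n / 2 : ℕ) : ℝ) ^ (-a) := hA (n / 2) hk1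
      _ ≤ |C₁| * ((n / 2 : ℕ) : ℝ) ^ (-a) :=
          mul_le_mul_of_nonneg_right (le_abs_self _) (Real.rpow_nonneg hkx.le _)
      _ ≤ |C₁| * (max (4 ^ a) 1 * (n : ℝ) ^ (-a)) :=
          mul_le_mul_of_nonneg_left (rpow_neg_le_max_mul (by norm_num) hkx hk_le hk_ge a) (abs_nonneg _)
  have hj1 : 1 ≤ n - n / 2 := by omega
  have hjx : (0 : ℝ) < ((n - n / 2 : ℕ) : ℝ) := Nat.cast_pos.2 (by omega)
  have hj_le : ((n - n / 2 : ℕ) : ℝ) ≤ (n : ℝ) := Nat.cast_le.2 (Nat.sub_le n (n / 2))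
  have hj_ge : (n : ℝ) ≤ 2 * ((n - n / 2 : ℕ) : ℝ) := by
    have h2 : n ≤ 2 * (n - n / 2) := by omega
    have h3 : ((n : ℕ) : ℝ) ≤ ((2 * (n - n / 2) : ℕ) : ℝ) := Nat.cast_le.2 h2
    simpa only [Nat.cast_mul, Nat.cast_ofNat] using h3
  have hGr : Gs (n - n / 2) ≤ |C₂| * (max (2 ^ b) 1 * (n : ℝ) ^ (-b)) :=
    calc Gs (n - n / 2) ≤ C₂ * ((n - n / 2 : ℕ) : ℝ) ^ (-b) := hB (n - n / 2) hj1
      _ ≤ |C₂| * ((n - n / 2 : ℕ) : ℝ) ^ (-b) :=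
          mul_le_mul_of_nonneg_right (le_abs_self _) (Real.rpow_nonneg hjx.le _)
      _ ≤ |C₂| * (max (2 ^ b) 1 * (n : ℝ) ^ (-b)) :=
          mul_le_mul_of_nonneg_left (rpow_neg_le_max_mul (by norm_num) hjx hj_le hj_ge b) (abs_nonneg _)
  -- combine
  have hC1 : |C₁| ≤ |C₁| + 1 := by linarith
  have hC2 : |C₂| ≤ |C₂| + 1 := by linarith
  calc 2 * ∑ v ∈ S n, h n v * g n v
      ≤ 2 * (((S n).card : ℝ) * (Hs (n / 2) * Gs (n - n / 2))) := by linarith [hsum]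
    _ ≤ 2 * ((96 * (n : ℝ) ^ (2 : ℕ)) * ((|C₁| * (max (4 ^ a) 1 * (n : ℝ) ^ (-a))) *
          (|C₂| * (max (2 ^ b) 1 * (n : ℝ) ^ (-b))))) := by
        refine mul_le_mul_of_nonneg_left ?_ (by norm_num)
        exact mul_le_mul (hS n hn1) (mul_le_mul hHr hGr (Gs0 _) (by positivity))
          (mul_nonneg (Hs0 _) (Gs0 _)) (by positivity)
    _ = 2 * 96 * |C₁| * |C₂| * max (4 ^ a) 1 * max (2 ^ b) 1 * (n : ℝ) ^ (2 - a - b) := by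
        rw [rpow_two_sub_sub hnpos]; ring
    _ ≤ 2 * 96 * (|C₁| + 1) * (|C₂| + 1) * max (4 ^ a) 1 * max (2 ^ b) 1 * (n : ℝ) ^ (2 - a - b) := by
        gcongr

end FloorOfArmRates

/-- **Stub `stub_floorOfArmRates`** (line `SketchIdeator5`, the typed ceiling of the two-sided charging class):
given the product floor `∏_{v ∈ ∂ⁱⁿΛ_m} (1 - P(inArm v n) P(outArm v n)) ≤ u_n(p)` and the two transfers
`P(inArm v n) ≤ P(halfSpaceReach 3 ⌊n/2⌋)`, `P(outArm v n) ≤ P(siteToBoundary 3 (n - ⌊n/2⌋))` (hypotheses;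
the line's stubs 1–3), a half-space reach rate `n^{-a}` and a one-arm rate `n^{-b}` at `p_c(ℤ³)` give
`exp(-C n^{2-a-b}) ≤ u_n` eventually. Smallness of the factors is unconditional (Barsky–Grimmett–Newman,
`tendsto_halfSpaceReach_half`); the rest is `FloorOfArmRates.floor_abstract`. -/
theorem stub_floorOfArmRates :
    (∀ (p : unitInterval) (n : ℕ), 1 ≤ n →
      ∏ v ∈ innerBoundary (zdGraph 3) (box 3 (n + n / 2)),
          (1 - (bondPercolation (zdGraph 3) p).real
                {ω | ∃ x ∈ box 3 n, ω ∈ openConnIn (↑(box 3 (n + n / 2)) : Set (Site 3)) v x} *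
              (bondPercolation (zdGraph 3) p).real
                {ω | ∃ y ∈ innerBoundary (zdGraph 3) (box 3 (2 * n)),
                  ω ∈ openConnIn (↑(box 3 (2 * n)) : Set (Site 3)) v y}) ≤
        (bondPercolation (zdGraph 3) p).real
          {ω | ¬ ∃ x ∈ box 3 n, ∃ y ∈ innerBoundary (zdGraph 3) (box 3 (2 * n)),
            ω ∈ openConnIn (↑(box 3 (2 * n)) : Set (Site 3)) x y}) →
    (∀ (p : unitInterval) (n : ℕ) (v : Site 3), v ∈ innerBoundary (zdGraph 3) (box 3 (n + n / 2)) →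
      (bondPercolation (zdGraph 3) p).real
          {ω | ∃ x ∈ box 3 n, ω ∈ openConnIn (↑(box 3 (n + n / 2)) : Set (Site 3)) v x} ≤
        (bondPercolation (zdGraph 3) p).real (halfSpaceReach 3 (n / 2))) →
    (∀ (p : unitInterval) (n : ℕ) (v : Site 3), 1 ≤ n → v ∈ innerBoundary (zdGraph 3) (box 3 (n + n / 2)) →
      (bondPercolation (zdGraph 3) p).real
          {ω | ∃ y ∈ innerBoundary (zdGraph 3) (box 3 (2 * n)),
            ω ∈ openConnIn (↑(box 3 (2 * n)) : Set (Site 3)) v y} ≤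
        (bondPercolation (zdGraph 3) p).real (siteToBoundary 3 (n - n / 2))) →
    ∀ a b : ℝ,
      (∃ C : ℝ, ∀ n : ℕ, 1 ≤ n →
        (bondPercolation (zdGraph 3) (criticalProbI 3)).real (halfSpaceReach 3 n) ≤ C * (n : ℝ) ^ (-a)) →
      (∃ C : ℝ, ∀ n : ℕ, 1 ≤ n →
        (bondPercolation (zdGraph 3) (criticalProbI 3)).real (siteToBoundary 3 n) ≤ C * (n : ℝ) ^ (-b)) →
      ∃ C : ℝ, 0 < C ∧ ∀ᶠ n : ℕ in atTop, Real.exp (-(C * (n : ℝ) ^ (2 - a - b))) ≤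
        (bondPercolation (zdGraph 3) (criticalProbI 3)).real
          {ω | ¬ ∃ x ∈ box 3 n, ∃ y ∈ innerBoundary (zdGraph 3) (box 3 (2 * n)),
            ω ∈ openConnIn (↑(box 3 (2 * n)) : Set (Site 3)) x y} := by
  intro hpf hin hout a b hA hB
  obtain ⟨C₁, h₁⟩ := hA
  obtain ⟨C₂, h₂⟩ := hB
  exact FloorOfArmRates.floor_abstract (fun n => innerBoundary (zdGraph 3) (box 3 (n + n / 2)))
    (fun t => (bondPercolation (zdGraph 3) (criticalProbI 3)).real (halfSpaceReach 3 t))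
    (fun t => (bondPercolation (zdGraph 3) (criticalProbI 3)).real (siteToBoundary 3 t))
    (u := fun n => (bondPercolation (zdGraph 3) (criticalProbI 3)).real
      {ω | ¬ ∃ x ∈ box 3 n, ∃ y ∈ innerBoundary (zdGraph 3) (box 3 (2 * n)),
        ω ∈ openConnIn (↑(box 3 (2 * n)) : Set (Site 3)) x y})
    (h := fun n v => (bondPercolation (zdGraph 3) (criticalProbI 3)).real
      {ω | ∃ x ∈ box 3 n, ω ∈ openConnIn (↑(box 3 (n + n / 2)) : Set (Site 3)) v x})
    (g := fun n v => (bondPercolation (zdGraph 3) (criticalProbI 3)).real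
      {ω | ∃ y ∈ innerBoundary (zdGraph 3) (box 3 (2 * n)),
        ω ∈ openConnIn (↑(box 3 (2 * n)) : Set (Site 3)) v y})
    (fun n hn => hpf (criticalProbI 3) n hn) (fun n v hv => hin (criticalProbI 3) n v hv)
    (fun n v hn hv => hout (criticalProbI 3) n v hn hv)
    (fun _ _ => measureReal_nonneg) (fun _ _ => measureReal_nonneg) (fun _ _ => measureReal_le_one)
    (fun _ => measureReal_nonneg) (fun _ => measureReal_nonneg)
    (fun n hn => FloorOfArmRates.card_midSphere_le_real hn)
    FloorOfArmRates.tendsto_halfSpaceReach_half h₁ h₂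

end Summit.CriticalPhenomena.PercolationContinuityZ3.Theorems.SubpolynomialBlocking

end
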